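import Literature.Probability.LatticeModels.WeightedCurrentsDictionary
import Literature.Probability.LatticeModels.GKSInequalities
import HarnessLib

/-!
# Griffiths monotonicity of sourceless current sums in the graph (edge-dependent couplings)

Topic `Literature/Probability/LatticeModels`. For edge couplings `K ≥ 0` on a finite simple graph `G` and the
`ℝ≥0∞` current sums `Z_{G₁,K}[A] = ecurrentSumIn G₁ K A` of `WeightedCurrents.lean` (currents of `G`
supported on a subgraph `G₁`, sources `A`), this file proves the **supermodularity of the sourceless sums in
the graph**: for vertex sets `S₁, S₂` (`offGraph G S` = `G` with the edges meeting `S` deleted),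

  `Z_{G∖S₁}[∅] · Z_{G∖S₂}[∅] ≤ Z_G[∅] · Z_{G∖(S₁∪S₂)}[∅]`      (`ecurrentSumIn_offGraph_empty_mul_le`),

i.e. `log Z[∅]` is supermodular in the edge set. Since `2^{|V|} Z_K[∅] = ∑_σ exp(∑_e K_e σ_e)` is the Ising
partition function with couplings `K` (the dictionary `sum_spinProduct_mul_prod_exp_eq` of
`WeightedCurrentsDictionary.lean`) and deleting edges is setting couplings to `0`, this is the classical
consequence of the GKS inequalities that `𝒵(K + d)/𝒵(K)` is nondecreasing in the nonnegative couplings `K`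
for a nonnegative increment `d` (Griffiths 1967; Kelly–Sherman 1968; Friedli–Velenik 2017, Thm. 3.49 and
Exercise 3.31): one coupling at a time, `𝒵(K + kδ_i) = 𝒵(K)(cosh k + sinh k ⟨ω_{C_i}⟩_K)` with `⟨ω_{C_i}⟩_K ≥ 0`
nondecreasing in `K` (GKS I, and Griffiths' comparison inequality `gksExpect_mono_of_abs_le` of
`GKSInequalities.lean`). It is the "Griffiths II" input of Aizenman's bound on the deviation of the
`2n`-point function from its Gaussian (Wick) value (Aizenman 1982, Lemma 9.3 (iii)–(iv) and eq. (9.14): the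
weights `z(B)` of the random-walk representation are super-multiplicative in the set of deleted bonds), used in
`AizenmanWickCurrents.lean`.

## Contents

* `gksSum_one_add_single` — `𝒵(K + kδ_i) = cosh k · 𝒵(K) + sinh k · 𝒵(K)⟨ω_{C_i}⟩_K` for the spin systems
  `ν_{Λ;K}` of Friedli–Velenik §3.8.1 (`gksSum`);
* `gksSum_one_mono` — `0 ≤ K ≤ K' ⇒ 𝒵(K) ≤ 𝒵(K')`; `gksSum_one_supermod` —
  `0 ≤ K₀ ≤ K₁`, `d ≥ 0 ⇒ 𝒵(K₁ + d) 𝒵(K₀) ≥ 𝒵(K₀ + d) 𝒵(K₁)`;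
* `cutCoupling K S` (couplings set to `0` on the edges meeting `S`), `ecurrentSumIn_offGraph_eq_cutCoupling`
  (`Z_{G∖S,K}[A] = Z_{K·1_{off S}}[A]`), `gksSum_edgeEnds_one_eq` (the dictionary for `A = ∅`), and the main
  inequality `ecurrentSumIn_offGraph_empty_mul_le`.

## References

* M. Aizenman, *Geometric analysis of φ⁴ fields and Ising models*, Comm. Math. Phys. 86 (1982) 1–48, Lemma 9.3
  and eq. (9.14) (Griffiths II for the bond-deleted partition functions) [AizenmanCMP1982] (read, Project Euclid).
* S. Friedli, Y. Velenik, *Statistical Mechanics of Lattice Systems*, CUP 2017, Thm. 3.49, Exercises 3.30–3.31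
  [FriedliVelenik2017] — through `GKSInequalities.lean`.
* R. B. Griffiths, J. Math. Phys. 8 (1967); D. G. Kelly, S. Sherman, J. Math. Phys. 9 (1968) [KellySherman1968].

## Not here

Monotonicity of current sums with sources (`Z_{G₁}[A]/Z_{G₁}[∅]` nondecreasing in `G₁`) is the restricted
switching identity `ecurrentSumIn_empty_mul_ecurrentSum_pair` of `WeightedCurrentsIdentities.lean` and is not
restated.
-/

noncomputable section

open Finset
open scoped symmDiff ENNReal

namespace Literature.Probability.LatticeModels

/-! ### Partition functions of `ν_{Λ;K}`: one coupling at a time -/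

section Supermodular

variable {Λ ι : Type*} [Fintype Λ] [DecidableEq Λ] [Fintype ι] [DecidableEq ι] (C : ι → Finset Λ)

omit [Fintype Λ] [DecidableEq Λ] in
/-- Adding `k` to one coupling multiplies the Boltzmann weight by `exp(k ω_{C_i}) = cosh k + ω_{C_i} sinh k`.
[cite: FriedliVelenik2017, §3.8.1, p. 141] -/
theorem gksWeight_add_single (K : ι → ℝ) (i : ι) (k : ℝ) (ω : SpinConfig Λ) :
    gksWeight univ (K + Pi.single i k) C ω =
      gksWeight univ K C ω * (Real.cosh k + spinProduct (C i) ω * Real.sinh k) := by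
  rw [gksWeight, gksWeight, gksHamiltonian, gksHamiltonian, ← exp_mul_eq_cosh_add_mul_sinh k (spinProduct_eq_one_or (C i) ω),
    ← Real.exp_add]
  congr 1
  simp only [Pi.add_apply, add_mul, Finset.sum_add_distrib]
  congr 1
  rw [Finset.sum_eq_single i (fun j _ hj => by rw [Pi.single_eq_of_ne hj, zero_mul]) (fun hi => absurd (mem_univ i) hi),
    Pi.single_eq_same]

/-- **One coupling at a time**: `𝒵(K + kδ_i) = cosh k · 𝒵(K) + sinh k · 𝒵(K)⟨ω_{C_i}⟩_K`
(unnormalised, `gksSum`). [cite: FriedliVelenik2017, §3.8.1, p. 141] -/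
theorem gksSum_one_add_single (K : ι → ℝ) (i : ι) (k : ℝ) :
    gksSum univ (K + Pi.single i k) C (fun _ => 1) =
      Real.cosh k * gksSum univ K C (fun _ => 1) + Real.sinh k * gksSum univ K C (spinProduct (C i)) := by
  simp only [gksSum, one_mul, gksWeight_add_single C K i k, Finset.mul_sum, ← Finset.sum_add_distrib]
  exact Finset.sum_congr rfl fun ω _ => by ring

omit [Fintype ι] in
/-- Splitting off one coordinate of an increment: `d = d|_{d_i := 0} + d_i δ_i`. [folklore] -/
theorem eq_update_add_single (d : ι → ℝ) (i : ι) : d = Function.update d i 0 + Pi.single i (d i) := by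
  funext j
  by_cases hj : j = i
  · subst hj; simp
  · simp [hj]

/-- **Monotonicity of the partition function in nonnegative couplings** (GKS I): `0 ≤ K`, `0 ≤ d` imply
`𝒵(K) ≤ 𝒵(K + d)`. [cite: FriedliVelenik2017, Thm. 3.49 and Exercise 3.31] -/
theorem gksSum_one_le_add (F : Finset ι) :
    ∀ (d : ι → ℝ), (∀ i, 0 ≤ d i) → (∀ i ∉ F, d i = 0) → ∀ (K : ι → ℝ), (∀ i, 0 ≤ K i) →
      gksSum univ K C (fun _ => 1) ≤ gksSum univ (K + d) C (fun _ => 1) := by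
  induction F using Finset.induction_on with
  | empty =>
    intro d _ hd0 K _
    have : d = 0 := funext fun i => hd0 i (by simp)
    rw [this, add_zero]
  | @insert i F hiF ih =>
    intro d hd hdF K hK
    set d' : ι → ℝ := Function.update d i 0 with hd'
    have hd'0 : ∀ j, 0 ≤ d' j := fun j => by
      by_cases hj : j = i
      · subst hj; simp [hd']
      · simp [hd', hj, hd j]
    have hd'F : ∀ j ∉ F, d' j = 0 := fun j hj => by
      by_cases hji : j = i
      · subst hji; simp [hd']
      · simp only [hd', Function.update_of_ne hji]
        exact hdF j (by simp [hji, hj])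
    have hsplit : K + d = (K + d') + Pi.single i (d i) := by
      rw [add_assoc, ← eq_update_add_single d i]
    have hKd' : ∀ j, 0 ≤ (K + d') j := fun j => add_nonneg (hK j) (hd'0 j)
    rw [hsplit, gksSum_one_add_single]
    have h1 := ih d' hd'0 hd'F K hK
    have hZ : 0 ≤ gksSum univ (K + d') C (fun _ => 1) := (gksSum_one_pos univ (K + d') C).le
    have hS : 0 ≤ gksSum univ (K + d') C (spinProduct (C i)) :=
      gksSum_spinProduct_nonneg univ (K + d') C (fun j _ => hKd' j) (C i)
    have hcosh : 1 ≤ Real.cosh (d i) := Real.one_le_cosh _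
    have hsinh : 0 ≤ Real.sinh (d i) := Real.sinh_nonneg_iff.2 (hd i)
    nlinarith

/-- **Supermodularity of the partition function in nonnegative couplings** (GKS II in Griffiths' comparison
form): for `0 ≤ K₀ ≤ K₁` and an increment `d ≥ 0`, `𝒵(K₀ + d) 𝒵(K₁) ≤ 𝒵(K₁ + d) 𝒵(K₀)` — the ratio
`𝒵(K + d)/𝒵(K) = ∏ (cosh + sinh·⟨ω_C⟩)` is nondecreasing in `K`. [cite: FriedliVelenik2017, Thm. 3.49 and Exercise 3.31] -/
theorem gksSum_one_supermod (F : Finset ι) :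
    ∀ (d : ι → ℝ), (∀ i, 0 ≤ d i) → (∀ i ∉ F, d i = 0) → ∀ (K₀ K₁ : ι → ℝ), (∀ i, 0 ≤ K₀ i) → (∀ i, K₀ i ≤ K₁ i) →
      gksSum univ (K₀ + d) C (fun _ => 1) * gksSum univ K₁ C (fun _ => 1) ≤
        gksSum univ (K₁ + d) C (fun _ => 1) * gksSum univ K₀ C (fun _ => 1) := by
  induction F using Finset.induction_on with
  | empty =>
    intro d _ hd0 K₀ K₁ _ _
    have : d = 0 := funext fun i => hd0 i (by simp)
    rw [this, add_zero, add_zero, mul_comm]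
  | @insert i F hiF ih =>
    intro d hd hdF K₀ K₁ hK₀ hK₁
    set d' : ι → ℝ := Function.update d i 0 with hd'
    have hd'0 : ∀ j, 0 ≤ d' j := fun j => by
      by_cases hj : j = i
      · subst hj; simp [hd']
      · simp [hd', hj, hd j]
    have hd'F : ∀ j ∉ F, d' j = 0 := fun j hj => by
      by_cases hji : j = i
      · subst hji; simp [hd']
      · simp only [hd', Function.update_of_ne hji]
        exact hdF j (by simp [hji, hj])
    have hsplit : ∀ K : ι → ℝ, K + d = (K + d') + Pi.single i (d i) := fun K => by
      rw [add_assoc, ← eq_update_add_single d i]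
    have hK₀d' : ∀ j, 0 ≤ (K₀ + d') j := fun j => add_nonneg (hK₀ j) (hd'0 j)
    have hle : ∀ j ∈ (univ : Finset ι), |(K₀ + d') j| ≤ (K₁ + d') j := fun j _ => by
      rw [abs_of_nonneg (hK₀d' j)]
      simp only [Pi.add_apply]
      linarith [hK₁ j]
    rw [hsplit K₀, hsplit K₁, gksSum_one_add_single, gksSum_one_add_single]
    -- notation
    set Z₀ := gksSum univ K₀ C (fun _ => 1)
    set Z₁ := gksSum univ K₁ C (fun _ => 1)
    set Z₀' := gksSum univ (K₀ + d') C (fun _ => 1)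
    set Z₁' := gksSum univ (K₁ + d') C (fun _ => 1)
    set S₀ := gksSum univ (K₀ + d') C (spinProduct (C i))
    set S₁ := gksSum univ (K₁ + d') C (spinProduct (C i))
    have hIH : Z₀' * Z₁ ≤ Z₁' * Z₀ := ih d' hd'0 hd'F K₀ K₁ hK₀ hK₁
    have hZ₀ : 0 < Z₀ := gksSum_one_pos univ K₀ C
    have hZ₁ : 0 < Z₁ := gksSum_one_pos univ K₁ C
    have hZ₀' : 0 < Z₀' := gksSum_one_pos univ (K₀ + d') C
    have hZ₁' : 0 < Z₁' := gksSum_one_pos univ (K₁ + d') C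
    have hS₀ : 0 ≤ S₀ := gksSum_spinProduct_nonneg univ (K₀ + d') C (fun j _ => hK₀d' j) (C i)
    -- `⟨ω_i⟩_{K₀+d'} ≤ ⟨ω_i⟩_{K₁+d'}` (Griffiths' comparison), i.e. `S₀ Z₁' ≤ S₁ Z₀'`
    have hmono : S₀ / Z₀' ≤ S₁ / Z₁' := gksExpect_mono_of_abs_le univ C hle (C i)
    rw [div_le_div_iff₀ hZ₀' hZ₁'] at hmono
    have hcosh : 0 ≤ Real.cosh (d i) := (Real.cosh_pos _).le
    have hsinh : 0 ≤ Real.sinh (d i) := Real.sinh_nonneg_iff.2 (hd i)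
    -- `S₀ Z₁ ≤ S₁ Z₀`: multiply `hmono` by `Z₁ Z₀ > 0`-free combination using `hIH`
    have hS : S₀ * Z₁ ≤ S₁ * Z₀ := by
      -- `S₀ Z₁ Z₁' ≤ S₀ ... `: from `S₀ Z₁' ≤ S₁ Z₀'` and `Z₀' Z₁ ≤ Z₁' Z₀`
      have h1 : S₀ * Z₁ * Z₁' ≤ S₁ * Z₀ * Z₁' := by
        calc S₀ * Z₁ * Z₁' = (S₀ * Z₁') * Z₁ := by ring
          _ ≤ (S₁ * Z₀') * Z₁ := mul_le_mul_of_nonneg_right hmono hZ₁.le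
          _ = S₁ * (Z₀' * Z₁) := by ring
          _ ≤ S₁ * (Z₁' * Z₀) := by
              refine mul_le_mul_of_nonneg_left hIH ?_
              -- `S₁ ≥ 0`
              exact gksSum_spinProduct_nonneg univ (K₁ + d') C
                (fun j _ => (hK₀d' j).trans ((abs_of_nonneg (hK₀d' j)).symm.le.trans (hle j (mem_univ j)))) (C i)
          _ = S₁ * Z₀ * Z₁' := by ring
      exact le_of_mul_le_mul_right h1 hZ₁'
    nlinarith [mul_nonneg hcosh (sub_nonneg.2 hIH), mul_nonneg hsinh (sub_nonneg.2 hS)]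

end Supermodular

/-! ### Current sums of subgraphs as current sums with cut-off couplings -/

section Currents

variable {V : Type*} [Fintype V] [DecidableEq V] {G : SimpleGraph V} [DecidableRel G.Adj]

/-- The couplings cut off at a vertex set: `K_e` on the edges off `S`, `0` on the edges meeting `S` (the couplings
of the restricted state `⟨·⟩_{Λ∖S}`). [folklore] -/
def cutCoupling (K : G.edgeFinset → ℝ) (S : Finset V) : G.edgeFinset → ℝ := fun e =>
  if Current.EdgeOff S (e : Sym2 V) then K e else 0

/-- `cutCoupling K S ≥ 0` for `K ≥ 0`. [folklore] -/
theorem cutCoupling_nonneg {K : G.edgeFinset → ℝ} (hK : ∀ e, 0 ≤ K e) (S : Finset V) (e : G.edgeFinset) :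
    0 ≤ cutCoupling K S e := by
  unfold cutCoupling; split_ifs <;> simp [hK e]

/-- `cutCoupling K S ≤ K` for `K ≥ 0`. [folklore] -/
theorem cutCoupling_le {K : G.edgeFinset → ℝ} (hK : ∀ e, 0 ≤ K e) (S : Finset V) (e : G.edgeFinset) :
    cutCoupling K S e ≤ K e := by
  unfold cutCoupling; split_ifs <;> simp [hK e]

omit [Fintype V] [DecidableRel G.Adj] in
/-- An edge is off `S₁ ∪ S₂` iff it is off `S₁` and off `S₂`. [folklore] -/
theorem edgeOff_union_iff (S₁ S₂ : Finset V) (e : Sym2 V) :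
    Current.EdgeOff (S₁ ∪ S₂) e ↔ Current.EdgeOff S₁ e ∧ Current.EdgeOff S₂ e := by
  simp only [Current.EdgeOff, Finset.mem_union, not_or]
  exact ⟨fun h => ⟨fun v hv => (h v hv).1, fun v hv => (h v hv).2⟩, fun h v hv => ⟨h.1 v hv, h.2 v hv⟩⟩

/-- Cutting off at `S₁` and then at `S₂` is cutting off at `S₁ ∪ S₂`. [folklore] -/
theorem cutCoupling_cutCoupling (K : G.edgeFinset → ℝ) (S₁ S₂ : Finset V) :
    cutCoupling (cutCoupling K S₁) S₂ = cutCoupling K (S₁ ∪ S₂) := by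
  funext e
  simp only [cutCoupling]
  by_cases h1 : Current.EdgeOff S₁ (e : Sym2 V) <;> by_cases h2 : Current.EdgeOff S₂ (e : Sym2 V) <;>
    simp [h1, h2, edgeOff_union_iff]

/-- The weight for the cut-off couplings is the weight restricted to the currents supported off `S`. [folklore] -/
theorem wweight_cutCoupling (K : G.edgeFinset → ℝ) (S : Finset V) (n : Current G) :
    n.wweight (cutCoupling K S) = if Current.IsSupp (offGraph G S) n then n.wweight K else 0 := by
  unfold Current.wweight
  split_ifs with hs
  · refine Finset.prod_congr rfl fun e _ => ?_
    unfold cutCoupling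
    split_ifs with he
    · rfl
    · rw [(isSupp_offGraph_iff.1 hs) e he]; simp
  · rw [isSupp_offGraph_iff] at hs
    push Not at hs
    obtain ⟨e, he, hne⟩ := hs
    refine Finset.prod_eq_zero (Finset.mem_univ e) ?_
    rw [cutCoupling, if_neg he, zero_pow hne, zero_div]

/-- **Subgraph sums as cut-off sums**: `Z_{G∖S,K}[A] = Z_{K·1_{off S}}[A]`. [folklore] -/
theorem ecurrentSumIn_offGraph_eq_cutCoupling (K : G.edgeFinset → ℝ) (S A : Finset V) :
    ecurrentSumIn (offGraph G S) K A = ecurrentSum (cutCoupling K S) A := by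
  unfold ecurrentSumIn ecurrentSum Current.eweight
  refine tsum_congr fun n => ?_
  rw [wweight_cutCoupling]
  by_cases hs : Current.IsSupp (offGraph G S) n <;> by_cases hA : n.sources = A <;> simp [hs, hA]

/-- The endpoints of an edge as a finite set of sites (the support `C_e = {u,v}` of the coupling `K_e`).
[folklore] -/
def edgeEnds (e : G.edgeFinset) : Finset V := (e : Sym2 V).toFinset

/-- `ω_{C_e} = σ_u σ_v`: the spin product over the endpoints is the bond spin. [folklore] -/
theorem spinProduct_edgeEnds (e : G.edgeFinset) (σ : SpinConfig V) : spinProduct (edgeEnds e) σ = bondSpin σ (e : Sym2 V) :=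
  (bondSpin_eq_spinProduct_toFinset
    (SimpleGraph.not_isDiag_of_mem_edgeSet G (SimpleGraph.mem_edgeFinset.1 e.2)) σ).symm

/-- The Boltzmann weight of `ν_{V;K}` with the edge supports is `∏_e exp(K_e σ_e)`. [cite: FriedliVelenik2017, §3.8.1 and Exercise 3.30] -/
theorem gksWeight_edgeEnds (K : G.edgeFinset → ℝ) (σ : SpinConfig V) :
    gksWeight univ K edgeEnds σ = ∏ e : G.edgeFinset, Real.exp (K e * bondSpin σ (e : Sym2 V)) := by
  rw [gksWeight, gksHamiltonian, Real.exp_sum]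
  exact Finset.prod_congr rfl fun e _ => by rw [spinProduct_edgeEnds]

/-- **The dictionary for the partition function**: `𝒵(K) = ∑_σ ∏_e exp(K_e σ_e) = 2^{|V|} Z_K[∅]` (`K ≥ 0`).
[cite: Panis2023Triviality, §4.1] -/
theorem gksSum_edgeEnds_one_eq {K : G.edgeFinset → ℝ} (hK : ∀ e, 0 ≤ K e) :
    gksSum univ K edgeEnds (fun _ => 1) = (2 : ℝ) ^ Fintype.card V * wcurrentSum K ∅ := by
  rw [← sum_spinProduct_mul_prod_exp_eq hK ∅]
  simp only [gksSum, one_mul, gksWeight_edgeEnds, spinProduct_empty]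

/-- The real form of the main inequality: `Z_{K^{S₁}}[∅] Z_{K^{S₂}}[∅] ≤ Z_K[∅] Z_{K^{S₁∪S₂}}[∅]` for the cut-off
couplings `K^S = cutCoupling K S`. [cite: AizenmanCMP1982, Lemma 9.3 and eq. (9.14)] -/
theorem wcurrentSum_cutCoupling_empty_mul_le {K : G.edgeFinset → ℝ} (hK : ∀ e, 0 ≤ K e) (S₁ S₂ : Finset V) :
    wcurrentSum (cutCoupling K S₁) ∅ * wcurrentSum (cutCoupling K S₂) ∅ ≤
      wcurrentSum K ∅ * wcurrentSum (cutCoupling K (S₁ ∪ S₂)) ∅ := by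
  -- couplings: `K₀ = K^{12} ≤ K₁ = K^{2}`, increment `d = K - K^{2}`
  set K2 := cutCoupling K S₂ with hK2
  set K12 := cutCoupling K (S₁ ∪ S₂) with hK12
  set d : G.edgeFinset → ℝ := fun e => K e - K2 e with hd
  have hK2n : ∀ e, 0 ≤ K2 e := cutCoupling_nonneg hK S₂
  have hK12n : ∀ e, 0 ≤ K12 e := cutCoupling_nonneg hK (S₁ ∪ S₂)
  have hdn : ∀ e, 0 ≤ d e := fun e => sub_nonneg.2 (cutCoupling_le hK S₂ e)
  have hK12' : K12 = cutCoupling K2 S₁ := by rw [hK12, hK2, cutCoupling_cutCoupling, Finset.union_comm]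
  have h12le : ∀ e, K12 e ≤ K2 e := fun e => by
    rw [hK12']
    exact cutCoupling_le hK2n S₁ e
  have hKd : K2 + d = K := funext fun e => by simp [hd]
  -- `K^{1} ≤ K^{12} + d`
  have h1le : ∀ e, cutCoupling K S₁ e ≤ (K12 + d) e := fun e => by
    have hu : Current.EdgeOff (S₁ ∪ S₂) (e : Sym2 V) ↔
        Current.EdgeOff S₁ (e : Sym2 V) ∧ Current.EdgeOff S₂ (e : Sym2 V) := edgeOff_union_iff S₁ S₂ _
    have hKe := hK e
    simp only [Pi.add_apply, hd, hK12, hK2, cutCoupling]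
    by_cases h1 : Current.EdgeOff S₁ (e : Sym2 V) <;> by_cases h2 : Current.EdgeOff S₂ (e : Sym2 V) <;>
      simp only [h1, h2, hu, and_self, and_true, and_false, if_true, if_false] <;> linarith
  have h1d : K12 + d = cutCoupling K S₁ + fun e => (K12 + d) e - cutCoupling K S₁ e :=
    funext fun e => by simp
  -- the two GKS steps, in `gksSum` language
  have hpow : (0 : ℝ) < (2 : ℝ) ^ Fintype.card V := by positivity
  have hmono : gksSum univ (cutCoupling K S₁) edgeEnds (fun _ => 1) ≤ gksSum univ (K12 + d) edgeEnds (fun _ => 1) := by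
    rw [h1d]
    exact gksSum_one_le_add edgeEnds univ _ (fun e => sub_nonneg.2 (h1le e)) (fun e he => absurd (mem_univ e) he)
      _ (cutCoupling_nonneg hK S₁)
  have hsuper : gksSum univ (K12 + d) edgeEnds (fun _ => 1) * gksSum univ K2 edgeEnds (fun _ => 1) ≤
      gksSum univ (K2 + d) edgeEnds (fun _ => 1) * gksSum univ K12 edgeEnds (fun _ => 1) :=
    gksSum_one_supermod edgeEnds univ d hdn (fun e he => absurd (mem_univ e) he) K12 K2 hK12n h12le
  rw [hKd] at hsuper
  have hZ2 : 0 ≤ gksSum univ K2 edgeEnds (fun _ => 1) := (gksSum_one_pos univ K2 edgeEnds).le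
  have key : gksSum univ (cutCoupling K S₁) edgeEnds (fun _ => 1) * gksSum univ K2 edgeEnds (fun _ => 1) ≤
      gksSum univ K edgeEnds (fun _ => 1) * gksSum univ K12 edgeEnds (fun _ => 1) :=
    (mul_le_mul_of_nonneg_right hmono hZ2).trans hsuper
  rw [gksSum_edgeEnds_one_eq (cutCoupling_nonneg hK S₁), gksSum_edgeEnds_one_eq hK2n, gksSum_edgeEnds_one_eq hK,
    gksSum_edgeEnds_one_eq hK12n] at key
  have key' : (2 : ℝ) ^ Fintype.card V * (2 : ℝ) ^ Fintype.card V *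
      (wcurrentSum (cutCoupling K S₁) ∅ * wcurrentSum K2 ∅) ≤
      (2 : ℝ) ^ Fintype.card V * (2 : ℝ) ^ Fintype.card V * (wcurrentSum K ∅ * wcurrentSum K12 ∅) := by
    calc _ = (2 : ℝ) ^ Fintype.card V * wcurrentSum (cutCoupling K S₁) ∅ * ((2 : ℝ) ^ Fintype.card V * wcurrentSum K2 ∅) := by ring
      _ ≤ (2 : ℝ) ^ Fintype.card V * wcurrentSum K ∅ * ((2 : ℝ) ^ Fintype.card V * wcurrentSum K12 ∅) := key
      _ = _ := by ring
  exact le_of_mul_le_mul_left key' (mul_pos hpow hpow)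

/-- **Supermodularity of the sourceless current sums in the graph** (Griffiths II for the bond-deleted
partition functions; Aizenman 1982, Lemma 9.3 (iii)–(iv), eq. (9.14)): for edge couplings `K ≥ 0` on a finite
simple graph and vertex sets `S₁, S₂`,
`Z_{G∖S₁}[∅] · Z_{G∖S₂}[∅] ≤ Z_G[∅] · Z_{G∖(S₁∪S₂)}[∅]`, where `G∖S = offGraph G S` deletes the edges meeting
`S` and `Z_{G₁}[∅] = ecurrentSumIn G₁ K ∅`. [cite: AizenmanCMP1982, Lemma 9.3 and eq. (9.14)] -/
theorem ecurrentSumIn_offGraph_empty_mul_le {K : G.edgeFinset → ℝ} (hK : ∀ e, 0 ≤ K e) (S₁ S₂ : Finset V) :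
    ecurrentSumIn (offGraph G S₁) K ∅ * ecurrentSumIn (offGraph G S₂) K ∅ ≤
      ecurrentSum K ∅ * ecurrentSumIn (offGraph G (S₁ ∪ S₂)) K ∅ := by
  rw [ecurrentSumIn_offGraph_eq_cutCoupling, ecurrentSumIn_offGraph_eq_cutCoupling,
    ecurrentSumIn_offGraph_eq_cutCoupling, ecurrentSum_eq_ofReal (cutCoupling_nonneg hK S₁),
    ecurrentSum_eq_ofReal (cutCoupling_nonneg hK S₂), ecurrentSum_eq_ofReal hK,
    ecurrentSum_eq_ofReal (cutCoupling_nonneg hK (S₁ ∪ S₂)),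
    ← ENNReal.ofReal_mul (wcurrentSum_nonneg (cutCoupling_nonneg hK S₁) ∅),
    ← ENNReal.ofReal_mul (wcurrentSum_nonneg hK ∅)]
  exact ENNReal.ofReal_le_ofReal (wcurrentSum_cutCoupling_empty_mul_le hK S₁ S₂)

/-- The same with a general subgraph in place of `G` on the left is not needed; a convenient corollary: deleting
the edges meeting `S` from `G∖X` costs at most the factor it costs in `G`,
`Z_{G∖X}[∅] · Z_{G∖S}[∅] ≤ Z_G[∅] · Z_{G∖(X∪S)}[∅]` (restatement with the roles named as used in
`AizenmanWickCurrents`). [cite: AizenmanCMP1982, Lemma 9.3 and eq. (9.14)] -/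
theorem ecurrentSumIn_offGraph_empty_mul_le' {K : G.edgeFinset → ℝ} (hK : ∀ e, 0 ≤ K e) (X S : Finset V) :
    ecurrentSumIn (offGraph G S) K ∅ * ecurrentSumIn (offGraph G X) K ∅ ≤
      ecurrentSum K ∅ * ecurrentSumIn (offGraph G (X ∪ S)) K ∅ := by
  rw [Finset.union_comm]
  exact ecurrentSumIn_offGraph_empty_mul_le hK S X

end Currents

end Literature.Probability.LatticeModels

end
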